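import Literature.NumberTheory.LFunctions.CertifiedLFunctionUpsampling
import Literature.NumberTheory.LFunctions.CertifiedLFunctionWindowAliasingBound
import Literature.NumberTheory.LFunctions.CertifiedLFunctionUpsamplingTruncation
import Literature.NumberTheory.LFunctions.CertifiedLFunctionRealPhase
import HarnessLib

/-!
# Platt's rigorous up-sampling of `Λ_χ`, assembled: Theorem 8.2 applied to `W(t, χ)` with the
# aliasing bound of Lemma 8.5 and the truncation bound of Lemma 8.7 (Math. Comp. 85 (2016) §8)

Topic `Literature/NumberTheory/LFunctions`; namespace `Literature.NumberTheory.LFunctions`, engine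
sub-namespace `UpsamplingError`. Everything in this file is PROVED (standard axioms; no named fact,
no definition). Typed for the parity-realchar cell (D-0088 (4) literature-typing layer, row «Platt 2016
(Math. Comp., certified GRH/`L`-function computations)»): instrument provenance — this is the
certificate behind the zero-LOCATING step of Platt's GRH verification
`Literature.NumberTheory.LFunctions.platt2016_theorem71/72` (§10: "we routinely up-sampled the output
by a factor of 8 and then if necessary by 32, 128 and ultimately 512").

Platt, p. 3021: "For `t₀ ∈ ℝ` and `h > 0` define `W(t, χ) := Λ_χ(t) exp(-(t - t₀)²/(2h²))` so
`W(t₀, χ) = Λ_χ(t₀)`. We aim to estimate `W(t₀, χ)` from our samples using Theorems 8.1 and 8.2. […]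
To apply Theorem 8.1 rigorously, we need to examine two sources of error: • the error introduced by
truncating the sum, and • the error introduced if the function is only approximately band-limited. The
former will be dealt with on a case-by-case basis. The latter, referred to as aliasing […], is the
subject of a theorem due to Weiss." The paper bounds the aliasing integral `I_χ(A)` of Theorem 8.2
in Lemma 8.5 and the truncated tails `E` in Lemma 8.7, but never displays the assembled inequality;
this file proves it, from theorems of the tree only:

  `|Λ_χ(t₀) − Σ_{|n − At₀| < S} W(n/A, χ) sinc(πA(n/A − t₀))|`
  `  ≤ 2 (q/π)^{M/2} ζ(M+1/2) e^{M²/(2h²) − πAM} P(t₀, h)/(πM)`                     (Lemma 8.5)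
  `  + √π ζ(9/8) e^{1/6} 2^{5/4} (q/2π)^{5/16} G(0)/(1 − G(1)/G(0))`               (Lemma 8.7)

(`platt2016_upsampling_error`; `M = 5/2 − a_χ`, `P(t₀, h)` the integral of Lemma 8.4 — bounded by
`hπ(t₀ + h/√(2π) + 1 + 1/(2√2))` in `platt2016_lemma84` —, `G` the majorant of Lemma 8.6), for `χ`
primitive modulo `q > 1`, Platt's phase `ε_χ = e^{-iθ}`, `e^{2iθ} = ε(χ)` ("for suitably chosen `ε_χ`,
`Λ_χ` is real valued", p. 3009; `platt2016_completedL_real`), `h, A > 0`, `S ∈ ℤ_{>0}` with `A h ≤ S`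
and `t₀ ≥ 0` "large enough" in the explicit sense of `platt2016_lemma87` (`t₀ ≥ 12` suffices:
`platt2016_upsampling_error_of_twelve_le`). The provisos `A h ≤ S` and `t₀ ≥ 12` are those of
`CertifiedLFunctionUpsamplingTruncation.lean` (module docstring there, items 2–3); nothing else is
assumed — in particular NO bounded-variation hypothesis: Theorem 8.2 is used in the tree's general
cell-bound form (`Upsampling.norm_sub_tsum_sample_mul_sinc_le_of_cell_bound`), whose hypothesis is
discharged by the exponential decay of the spectrum of `W` that Platt's own proof of Lemma 8.5
establishes (the contour shift to `Re s = M + 1/2`).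

## Contents (all proved)

* `UpsamplingError.norm_integral_window_mul_exp_le` — the inner integral of `I_χ(A)` after the
  contour shift (proof of Lemma 8.5, p. 3023): `|∫ W(t,χ) e^{-ixt} dt| ≤ C e^{-Mx}` for every real `x`,
  `C = (q/π)^{M/2} ζ(M+1/2) e^{M²/(2h²)} P(t₀,h)`; `UpsamplingError.norm_fourier_window_le` — the same
  for Mathlib's `𝓕 W(η)` (`x = 2πη`); any `|ε| = 1`.
* `UpsamplingError.continuous_window`, `integrable_window` — `W(·, χ)` is continuous and integrable
  (the engine of `CertifiedLFunctionWindowAliasingBound.lean` on the line `Re s = 1/2`).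
* `UpsamplingError.norm_fourier_window_le_abs` — with Platt's phase, `W` is real, its spectrum is
  Hermitian-symmetric, and `‖𝓕 W(η)‖ ≤ C e^{-2πM|η|}` for ALL `η`;
  `UpsamplingError.integrable_fourier_window` (hypothesis (1) of Theorem 8.2 for `W`);
  `UpsamplingError.fourier_window_cell_bound` — the summable cell bounds
  `‖𝓕 W(ξ + kA)‖ ≤ C e^{πMA} e^{-2πMA|k|}` on `ξ ∈ (−A/2, A/2]`.
* `UpsamplingError.platt2016_upsampling_aliasing` — **Theorem 8.2 for `W(·, χ)` with Lemma 8.5's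
  bound**, at every real `t`: the cardinal series `Σ_n W(n/A) sinc(π(At − n))` converges and
  `|W(t, χ) − Σ_n W(n/A, χ) sinc(π(At − n))| ≤ I_χ(A) ≤ 2 (q/π)^{M/2} ζ(M+1/2) e^{M²/(2h²)−πAM} P(t₀,h)/(πM)`
  (`2∫_{|ξ| ∉ window} ‖𝓕W‖ = 4∫_{A/2}^∞ ‖𝓕W‖ = 4∫_{πA}^∞ |Ŵ(x)| dx = I_χ(A)` by the symmetry and
  `Upsampling.integral_Ioi_norm_plattFourier`, then `platt2016_lemma85`).
* **`platt2016_upsampling_error`**, `platt2016_upsampling_error_of_twelve_le` — the assembled bound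
  displayed above (`Σ_ℤ = Σ_{|n−At₀|<S} + Σ_{|n−At₀|≥S}`, `W(t₀, χ) = Λ_χ(t₀)`, triangle inequality,
  `platt2016_lemma87`); `platt2016_upsampling_error_uniform` — the same for EVERY `t₀ ≥ 0` (zeros near
  the real axis), with the truncation constant of `platt2016_lemma87_uniform`
  (`max(√π e^{1/6}, √(2π) e^{π/8+1/4}/3^{1/4})` in place of `√π e^{1/6}`);
  `platt2016_upsampling_error_explicit` — the closed form with `P(t₀, h) ≤ hπ(t₀ + h/√(2π) + 1 + 1/(2√2))`
  (Lemma 8.4, `platt2016_lemma84`) substituted.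

Conventions as in the companion files: `Λ_χ(t) = ε (q/π)^{it/2} Γ((1/2 + a_χ + it)/2) e^{πt/4} L_χ(1/2+it)`
written out over Mathlib's `DirichletCharacter.LFunction` and `Complex.Gamma`, `a_χ = charParity χ`,
`ζ(σ) = Booker2006Turing.bigZ σ`, `sinc = Real.sinc`, samples at `n/A`, `n ∈ ℤ`; the retained sum is the
`tsum` over the (finite) subtype `{n : ℤ // |n − At₀| < S}`.

NOT here: the numerical evaluation of the two bounds for Platt's parameters (`A = 64/5`, `h = 7/32`,
`S = 20`: `|E| < 8.3·10⁻⁸`, §9.5 — a computation), the interval evaluation of the retained sum, and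
Theorem 8.2 in Brown's full generality (see `CertifiedLFunctionUpsampling.lean`).

`lean search` (2026-08-27): the four imported files supply every ingredient (`platt2016_lemma85` and the
`WindowAliasing.*` engine, `Upsampling.hasSum_sample_mul_sinc_of_cell_bound` /
`norm_sub_tsum_sample_mul_sinc_le_of_cell_bound` / `integral_Ioi_norm_plattFourier`,
`platt2016_lemma87`, `platt2016_completedL_real`); Mathlib supplies `Real.fourier_real_eq_integral_exp_smul`,
`VectorFourier.fourierIntegral_continuous`, `integrableOn_exp_mul_Ioi/Iic`,
`Summable.tsum_subtype_add_tsum_subtype_compl`, `Summable.of_nat_of_neg`. No assembled up-sampling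
bound existed in the tree; nothing is restated.

## References

* [Platt2016GRH] D. J. Platt, *Numerical computations concerning the GRH*, Math. Comp. 85 (2016),
  no. 302, 3009–3027, doi:10.1090/mcom/3077 (journal pdf `paper:url-20e4f76cdba6`): `Λ_χ` p. 3009;
  §8 p. 3021 (`W(t, χ)`, "two sources of error"), Theorem 8.2 p. 3021, Lemma 8.5 p. 3022 (proof
  pp. 3022–3023), Lemmas 8.6–8.7 p. 3023; §9.5 p. 3025; §10 p. 3025.
-/

noncomputable section

open Complex Set MeasureTheory Filter DirichletCharacter
open scoped Real FourierTransform ComplexConjugate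

namespace Literature.NumberTheory.LFunctions

namespace UpsamplingError

open WindowAliasing UpsamplingTruncation

/-! ## §1 Real signals: Hermitian symmetry of the spectrum -/

/-- Hermitian symmetry of the spectrum of a real signal: `‖𝓕W(-ξ)‖ = ‖𝓕W(ξ)‖` when `Im W = 0`.
[folklore] -/
private theorem norm_fourier_neg_of_im_eq_zero {W : ℝ → ℂ} (hW : ∀ t, (W t).im = 0) (ξ : ℝ) :
    ‖𝓕 W (-ξ)‖ = ‖𝓕 W ξ‖ := by
  have hc : ∀ t, conj (W t) = W t := fun t => Complex.conj_eq_iff_im.mpr (hW t)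
  have : 𝓕 W (-ξ) = conj (𝓕 W ξ) := by
    rw [Real.fourier_real_eq_integral_exp_smul, Real.fourier_real_eq_integral_exp_smul,
      ← integral_conj]
    congr 1
    funext v
    simp only [smul_eq_mul, map_mul, ← Complex.exp_conj, Complex.conj_ofReal, Complex.conj_I, hc]
    congr 1
    push_cast
    ring
  rw [this, Complex.norm_conj]

/-- For a Hermitian-symmetric integrable spectrum, `2 ∫_{ξ ∉ (−A/2, A/2]} ‖𝓕W‖ = 4 ∫_{A/2}^∞ ‖𝓕W‖`
(`A ≥ 0`). [folklore] -/
private theorem two_mul_integral_compl_window {W : ℝ → ℂ} (hsymm : ∀ ξ, ‖𝓕 W (-ξ)‖ = ‖𝓕 W ξ‖)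
    (hFi : Integrable (𝓕 W)) {A : ℝ} (hA : 0 ≤ A) :
    2 * ∫ ξ in (Ioc (-(A / 2)) (A / 2))ᶜ, ‖𝓕 W ξ‖ = 4 * ∫ ξ in Ioi (A / 2), ‖𝓕 W ξ‖ := by
  rw [compl_Ioc, setIntegral_union (Iic_disjoint_Ioi (by linarith)) measurableSet_Ioi
    hFi.norm.integrableOn hFi.norm.integrableOn]
  have : ∫ ξ in Iic (-(A / 2)), ‖𝓕 W ξ‖ = ∫ ξ in Ioi (A / 2), ‖𝓕 W ξ‖ := by
    rw [← integral_comp_neg_Ioi]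
    simp_rw [hsymm]
  rw [this]
  ring

/-- `C e^{-c|η|}` is integrable on `ℝ` (`c > 0`). [folklore] -/
private theorem integrable_const_mul_exp_neg_mul_abs (C : ℝ) {c : ℝ} (hc : 0 < c) :
    Integrable fun η : ℝ => C * Real.exp (-c * |η|) := by
  refine Integrable.const_mul ?_ C
  have h1 : IntegrableOn (fun η : ℝ => Real.exp (-c * |η|)) (Iic 0) := by
    refine (integrableOn_exp_mul_Iic hc 0).congr_fun (fun η hη => ?_) measurableSet_Iic
    rw [abs_of_nonpos (mem_Iic.mp hη)]; ring_nf
  have h2 : IntegrableOn (fun η : ℝ => Real.exp (-c * |η|)) (Ioi 0) := by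
    refine (integrableOn_exp_mul_Ioi (a := -c) (by linarith) 0).congr_fun (fun η hη => ?_)
      measurableSet_Ioi
    rw [abs_of_pos (mem_Ioi.mp hη)]
  have := h1.union h2
  rwa [Iic_union_Ioi, integrableOn_univ] at this

/-- `Σ_{k ∈ ℤ} e^{-c|k|}` converges (`c > 0`). [folklore] -/
private theorem summable_exp_neg_mul_abs_int {c : ℝ} (hc : 0 < c) :
    Summable fun k : ℤ => Real.exp (-c * |(k : ℝ)|) := by
  have hr0 : 0 ≤ Real.exp (-c) := (Real.exp_pos _).le
  have hr1 : Real.exp (-c) < 1 := Real.exp_lt_one_iff.mpr (by linarith)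
  have hg : Summable fun n : ℕ => Real.exp (-c) ^ n := summable_geometric_of_lt_one hr0 hr1
  have e : ∀ n : ℕ, Real.exp (-c * (n : ℝ)) = Real.exp (-c) ^ n := fun n => by
    rw [← Real.exp_nat_mul]; ring_nf
  refine Summable.of_nat_of_neg ?_ ?_
  · refine hg.congr fun n => ?_
    rw [Int.cast_natCast, abs_of_nonneg (Nat.cast_nonneg _), e]
  · refine hg.congr fun n => ?_
    rw [Int.cast_neg, Int.cast_natCast, abs_neg, abs_of_nonneg (Nat.cast_nonneg _), e]

/-! ## §2 The spectrum of the windowed completed `L`-function (Platt, proof of Lemma 8.5) -/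

/-- **The inner integral of `I_χ(A)` after the contour shift** (Platt p. 3023, the step of the proof
of Lemma 8.5 before "integrating with respect to `x`"): for every real `x`,
`|∫ W(t, χ) e^{-ixt} dt| ≤ (q/π)^{M/2} ζ(M + 1/2) e^{M²/(2h²)} P(t₀, h) e^{-Mx}`, `M = 5/2 - a_χ`
(`χ` primitive mod `q > 1`, `|ε| = 1`, `h > 0`; `P(t₀, h)` the integral of Lemma 8.4).
[cite: Platt2016GRH, Lemma 8.5 p. 3022 (proof pp. 3022–3023)] -/
theorem norm_integral_window_mul_exp_le {q : ℕ} [NeZero q] (hq : 1 < q)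
    {χ : DirichletCharacter ℂ q} (hχ : χ.IsPrimitive) {ε : ℂ} (hε : ‖ε‖ = 1) (t₀ : ℝ) {h : ℝ}
    (hh : 0 < h) (x : ℝ) :
    ‖∫ t : ℝ, ε * ((q : ℂ) / π) ^ (I * t / 2) *
        Complex.Gamma ((1 / 2 + charParity χ + I * t) / 2) * Complex.exp (π * t / 4) *
        χ.LFunction (1 / 2 + I * t) * (Real.exp (-(t - t₀) ^ 2 / (2 * h ^ 2)) : ℂ) *
        Complex.exp (-I * x * t)‖ ≤
      ((q : ℝ) / π) ^ ((5 / 2 - charParity χ : ℝ) / 2) * Booker2006Turing.bigZ (3 - charParity χ) *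
        Real.exp ((5 / 2 - charParity χ : ℝ) ^ 2 / (2 * h ^ 2)) *
        (∫ t : ℝ, ‖Complex.Gamma ((3 + t * I) / 2)‖ * Real.exp (π * t / 4) *
          Real.exp (-(t - t₀) ^ 2 / (2 * h ^ 2))) *
        Real.exp (-(5 / 2 - charParity χ : ℝ) * x) := by
  have ha1 : (charParity χ : ℝ) ≤ 1 := by exact_mod_cast charParity_le_one χ
  have hab : (1 / 2 : ℝ) ≤ 3 - charParity χ := by linarith
  have h1 := integral_congr_ae (ae_of_all (volume : Measure ℝ) fun t =>
    window_mul_exp_eq χ ε t₀ x h t)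
  have hshift := Literature.Analysis.Complex.integral_vertical_eq_of_differentiableOn
    (F := fun s : ℂ => ε * ((q : ℂ) / π) ^ ((s - 1 / 2) / 2) *
      Complex.Gamma ((s + charParity χ) / 2) *
      Complex.exp (π * I * (1 / 2 - s) / 4) * χ.LFunction s * Complex.exp ((1 / 2 - s) * x) *
      Complex.exp (-(I * (1 / 2 - s) - t₀) ^ 2 / (2 * h ^ 2)))
    (a := 1 / 2) (b := 3 - charParity χ) hab
    (fun s hs => (differentiableAt_integrand hq hχ ε t₀ x h (s := s) hs.1).differentiableWithinAt)
    (integrable_integrand_vertical hq hχ hε t₀ x hh (σ := 1 / 2) le_rfl hab)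
    (integrable_integrand_vertical hq hχ hε t₀ x hh (σ := 3 - charParity χ) hab le_rfl)
    (decay_integrand hq hχ hε t₀ x hh)
  have hI := h1.trans hshift
  have hnear := (integrable_integrand_vertical hq hχ hε t₀ x hh (σ := 3 - charParity χ) hab
    le_rfl).norm
  have hfarI := (platt2016_lemma84_integrable t₀ hh).const_mul
    (((q : ℝ) / π) ^ ((5 / 2 - charParity χ : ℝ) / 2) *
      Booker2006Turing.bigZ (3 - charParity χ) *
      Real.exp (-(5 / 2 - charParity χ : ℝ) * x) *
      Real.exp ((5 / 2 - charParity χ : ℝ) ^ 2 / (2 * h ^ 2)))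
  rw [hI]
  refine (norm_integral_le_integral_norm _).trans ?_
  refine (integral_mono hnear hfarI fun y => norm_integrand_far_le hq hε t₀ x h y).trans (le_of_eq ?_)
  rw [integral_const_mul]
  ring

/-- The same bound for Mathlib's Fourier transform `𝓕 W(η) = ∫ W(t) e^{-2πiηt} dt` (`x = 2πη`):
`‖𝓕 W(η)‖ ≤ (q/π)^{M/2} ζ(M+1/2) e^{M²/(2h²)} P(t₀,h) e^{-2πMη}` for every real `η`.
[cite: Platt2016GRH, Lemma 8.5 p. 3022 (proof pp. 3022–3023)] -/
theorem norm_fourier_window_le {q : ℕ} [NeZero q] (hq : 1 < q)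
    {χ : DirichletCharacter ℂ q} (hχ : χ.IsPrimitive) {ε : ℂ} (hε : ‖ε‖ = 1) (t₀ : ℝ) {h : ℝ}
    (hh : 0 < h) (η : ℝ) :
    ‖𝓕 (fun t : ℝ => ε * ((q : ℂ) / π) ^ (I * t / 2) *
        Complex.Gamma ((1 / 2 + charParity χ + I * t) / 2) * Complex.exp (π * t / 4) *
        χ.LFunction (1 / 2 + I * t) * (Real.exp (-(t - t₀) ^ 2 / (2 * h ^ 2)) : ℂ)) η‖ ≤
      ((q : ℝ) / π) ^ ((5 / 2 - charParity χ : ℝ) / 2) * Booker2006Turing.bigZ (3 - charParity χ) *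
        Real.exp ((5 / 2 - charParity χ : ℝ) ^ 2 / (2 * h ^ 2)) *
        (∫ t : ℝ, ‖Complex.Gamma ((3 + t * I) / 2)‖ * Real.exp (π * t / 4) *
          Real.exp (-(t - t₀) ^ 2 / (2 * h ^ 2))) *
        Real.exp (-(5 / 2 - charParity χ : ℝ) * (2 * π * η)) := by
  have e : 𝓕 (fun t : ℝ => ε * ((q : ℂ) / π) ^ (I * t / 2) *
        Complex.Gamma ((1 / 2 + charParity χ + I * t) / 2) * Complex.exp (π * t / 4) *
        χ.LFunction (1 / 2 + I * t) * (Real.exp (-(t - t₀) ^ 2 / (2 * h ^ 2)) : ℂ)) η =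
      ∫ t : ℝ, ε * ((q : ℂ) / π) ^ (I * t / 2) *
        Complex.Gamma ((1 / 2 + charParity χ + I * t) / 2) * Complex.exp (π * t / 4) *
        χ.LFunction (1 / 2 + I * t) * (Real.exp (-(t - t₀) ^ 2 / (2 * h ^ 2)) : ℂ) *
        Complex.exp (-I * ((2 * π * η : ℝ) : ℂ) * t) := by
    rw [Real.fourier_real_eq_integral_exp_smul]
    congr 1
    funext t
    rw [smul_eq_mul, mul_comm]
    congr 1
    congr 1
    push_cast
    ring
  rw [e]
  exact norm_integral_window_mul_exp_le hq hχ hε t₀ hh (2 * π * η)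


/-! ## §3 The hypotheses of Theorem 8.2 for `W(t, χ)` -/

/-- `W(t, χ)` is continuous in `t` (`L_χ` entire, `Γ` pole-free on `Re > 0`).
[cite: Platt2016GRH, §8 p. 3021 (Theorem 8.1 applied to `W`)] -/
theorem continuous_window {q : ℕ} [NeZero q] (hq : 1 < q) {χ : DirichletCharacter ℂ q}
    (hχ : χ.IsPrimitive) (ε : ℂ) (t₀ h : ℝ) :
    Continuous fun t : ℝ => ε * ((q : ℂ) / π) ^ (I * t / 2) *
        Complex.Gamma ((1 / 2 + charParity χ + I * t) / 2) * Complex.exp (π * t / 4) *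
        χ.LFunction (1 / 2 + I * t) * (Real.exp (-(t - t₀) ^ 2 / (2 * h ^ 2)) : ℂ) := by
  have hGon : ContinuousOn (fun s : ℂ => ε * ((q : ℂ) / π) ^ ((s - 1 / 2) / 2) *
        Complex.Gamma ((s + charParity χ) / 2) *
        Complex.exp (π * I * (1 / 2 - s) / 4) * χ.LFunction s * Complex.exp ((1 / 2 - s) * (0 : ℝ)) *
        Complex.exp (-(I * (1 / 2 - s) - t₀) ^ 2 / (2 * h ^ 2))) {s : ℂ | 1 / 2 ≤ s.re} :=
    fun s (hs : 1 / 2 ≤ s.re) =>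
      (differentiableAt_integrand hq hχ ε t₀ 0 h (s := s) hs).continuousAt.continuousWithinAt
  have hl : Continuous fun t : ℝ => (((1 / 2 : ℝ) : ℂ) + t * I) := by fun_prop
  have hmem : ∀ t : ℝ, (((1 / 2 : ℝ) : ℂ) + t * I) ∈ {s : ℂ | 1 / 2 ≤ s.re} := fun t => by simp
  have hc := hGon.comp_continuous hl hmem
  refine hc.congr fun t => ?_
  have e := window_mul_exp_eq χ ε t₀ 0 h t
  beta_reduce at e
  simp only [Function.comp_apply]
  rw [← e]
  simp

/-- `W(t, χ)` is integrable (`|ε| = 1`, `h > 0`): the Gaussian window against the polynomial growth of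
`Λ_χ` (`WindowAliasing.integrable_integrand_vertical` on the line `Re s = 1/2`).
[cite: Platt2016GRH, §8 p. 3021 (Theorem 8.2 applied to `W`)] -/
theorem integrable_window {q : ℕ} [NeZero q] (hq : 1 < q) {χ : DirichletCharacter ℂ q}
    (hχ : χ.IsPrimitive) {ε : ℂ} (hε : ‖ε‖ = 1) (t₀ : ℝ) {h : ℝ} (hh : 0 < h) :
    Integrable fun t : ℝ => ε * ((q : ℂ) / π) ^ (I * t / 2) *
        Complex.Gamma ((1 / 2 + charParity χ + I * t) / 2) * Complex.exp (π * t / 4) *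
        χ.LFunction (1 / 2 + I * t) * (Real.exp (-(t - t₀) ^ 2 / (2 * h ^ 2)) : ℂ) := by
  have ha1 : (charParity χ : ℝ) ≤ 1 := by exact_mod_cast charParity_le_one χ
  have hab : (1 / 2 : ℝ) ≤ 3 - charParity χ := by linarith
  have hI := integrable_integrand_vertical hq hχ hε t₀ 0 hh (σ := 1 / 2) le_rfl hab
  refine hI.congr (ae_of_all _ fun t => ?_)
  have e := window_mul_exp_eq χ ε t₀ 0 h t
  beta_reduce at e
  beta_reduce
  rw [← e]
  simp

/-- Platt's phase: `|e^{-iθ}| = 1`. [cite: Platt2016GRH, §1 p. 3009 ("`|ε_χ| = 1`")] -/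
theorem norm_phase (θ : ℝ) : ‖Complex.exp (-(θ * I))‖ = 1 := by
  rw [show -((θ : ℂ) * I) = ((-θ : ℝ) : ℂ) * I by push_cast; ring]
  exact Complex.norm_exp_ofReal_mul_I _

/-- With Platt's phase `ε_χ = e^{-iθ}`, `e^{2iθ} = ε(χ)`, the window `W(t, χ)` is REAL
(`platt2016_completedL_real`), so its spectrum is Hermitian-symmetric and the one-sided bound of
§2 becomes two-sided: `‖𝓕 W(η)‖ ≤ (q/π)^{M/2} ζ(M+1/2) e^{M²/(2h²)} P(t₀,h) e^{-2πM|η|}`.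
[cite: Platt2016GRH, Lemma 8.5 p. 3022 (proof) with §1 p. 3009 (`Λ_χ` real)] -/
theorem norm_fourier_window_le_abs {q : ℕ} [NeZero q] (hq : 1 < q)
    {χ : DirichletCharacter ℂ q} (hχ : χ.IsPrimitive) {θ : ℝ}
    (hθ : Complex.exp (2 * θ * I) = rootNumber χ) (t₀ : ℝ) {h : ℝ} (hh : 0 < h) (η : ℝ) :
    ‖𝓕 (fun t : ℝ => Complex.exp (-(θ * I)) * ((q : ℂ) / π) ^ (I * t / 2) *
        Complex.Gamma ((1 / 2 + charParity χ + I * t) / 2) * Complex.exp (π * t / 4) *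
        χ.LFunction (1 / 2 + I * t) * (Real.exp (-(t - t₀) ^ 2 / (2 * h ^ 2)) : ℂ)) η‖ ≤
      ((q : ℝ) / π) ^ ((5 / 2 - charParity χ : ℝ) / 2) * Booker2006Turing.bigZ (3 - charParity χ) *
        Real.exp ((5 / 2 - charParity χ : ℝ) ^ 2 / (2 * h ^ 2)) *
        (∫ t : ℝ, ‖Complex.Gamma ((3 + t * I) / 2)‖ * Real.exp (π * t / 4) *
          Real.exp (-(t - t₀) ^ 2 / (2 * h ^ 2))) *
        Real.exp (-(5 / 2 - charParity χ : ℝ) * (2 * π * |η|)) := by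
  have hε := norm_phase θ
  have hreal : ∀ t : ℝ, (Complex.exp (-(θ * I)) * ((q : ℂ) / π) ^ (I * t / 2) *
        Complex.Gamma ((1 / 2 + charParity χ + I * t) / 2) * Complex.exp (π * t / 4) *
        χ.LFunction (1 / 2 + I * t) * (Real.exp (-(t - t₀) ^ 2 / (2 * h ^ 2)) : ℂ)).im = 0 := by
    intro t
    rw [Complex.im_mul_ofReal, platt2016_completedL_real hq hχ hθ t, zero_mul]
  rcases le_or_gt 0 η with hη | hη
  · rw [abs_of_nonneg hη]
    exact norm_fourier_window_le hq hχ hε t₀ hh η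
  · rw [abs_of_neg hη, show η = -(-η) by ring, norm_fourier_neg_of_im_eq_zero hreal, neg_neg]
    exact norm_fourier_window_le hq hχ hε t₀ hh (-η)

/-- The spectrum of `W(t, χ)` (Platt's phase) is integrable.
[cite: Platt2016GRH, Theorem 8.2 p. 3021 (hypothesis (1) for `W`)] -/
theorem integrable_fourier_window {q : ℕ} [NeZero q] (hq : 1 < q)
    {χ : DirichletCharacter ℂ q} (hχ : χ.IsPrimitive) {θ : ℝ}
    (hθ : Complex.exp (2 * θ * I) = rootNumber χ) (t₀ : ℝ) {h : ℝ} (hh : 0 < h) :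
    Integrable (𝓕 (fun t : ℝ => Complex.exp (-(θ * I)) * ((q : ℂ) / π) ^ (I * t / 2) *
        Complex.Gamma ((1 / 2 + charParity χ + I * t) / 2) * Complex.exp (π * t / 4) *
        χ.LFunction (1 / 2 + I * t) * (Real.exp (-(t - t₀) ^ 2 / (2 * h ^ 2)) : ℂ))) := by
  have ha1 : (charParity χ : ℝ) ≤ 1 := by exact_mod_cast charParity_le_one χ
  have hMpos : 0 < (5 / 2 - charParity χ : ℝ) := by linarith
  have hint := integrable_window hq hχ (norm_phase θ) t₀ hh
  have hcont : Continuous (𝓕 (fun t : ℝ => Complex.exp (-(θ * I)) * ((q : ℂ) / π) ^ (I * t / 2) *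
        Complex.Gamma ((1 / 2 + charParity χ + I * t) / 2) * Complex.exp (π * t / 4) *
        χ.LFunction (1 / 2 + I * t) * (Real.exp (-(t - t₀) ^ 2 / (2 * h ^ 2)) : ℂ))) :=
    VectorFourier.fourierIntegral_continuous Real.continuous_fourierChar
      (by exact continuous_inner) hint
  set C : ℝ := ((q : ℝ) / π) ^ ((5 / 2 - charParity χ : ℝ) / 2) *
        Booker2006Turing.bigZ (3 - charParity χ) *
        Real.exp ((5 / 2 - charParity χ : ℝ) ^ 2 / (2 * h ^ 2)) *
        (∫ t : ℝ, ‖Complex.Gamma ((3 + t * I) / 2)‖ * Real.exp (π * t / 4) *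
          Real.exp (-(t - t₀) ^ 2 / (2 * h ^ 2))) with hC
  have hg := integrable_const_mul_exp_neg_mul_abs C (c := (5 / 2 - charParity χ : ℝ) * (2 * π))
    (by positivity)
  refine hg.mono' hcont.aestronglyMeasurable (ae_of_all _ fun η => ?_)
  have hb := norm_fourier_window_le_abs hq hχ hθ t₀ hh η
  refine hb.trans (le_of_eq ?_)
  rw [hC]
  congr 1
  congr 1
  ring

/-- **Summable cell bounds for the spectrum of `W(t, χ)`** (the hypothesis of the tree's general form
of Theorem 8.2, `Upsampling.norm_sub_tsum_sample_mul_sinc_le_of_cell_bound`): on the window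
`ξ ∈ (−A/2, A/2]`, `‖𝓕 W(ξ + kA)‖ ≤ C e^{πMA} e^{-2πMA|k|}` with `C` the constant of §2, since
`|ξ + kA| ≥ |k|A − A/2`. [cite: Platt2016GRH, Theorem 8.2 p. 3021 (applied to `W`, §8)] -/
theorem fourier_window_cell_bound {q : ℕ} [NeZero q] (hq : 1 < q)
    {χ : DirichletCharacter ℂ q} (hχ : χ.IsPrimitive) {θ : ℝ}
    (hθ : Complex.exp (2 * θ * I) = rootNumber χ) (t₀ : ℝ) {h A : ℝ} (hh : 0 < h) (hA : 0 < A)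
    (k : ℤ) (ξ : ℝ) (hξ : ξ ∈ Ioc (-(A / 2)) (A / 2)) :
    ‖𝓕 (fun t : ℝ => Complex.exp (-(θ * I)) * ((q : ℂ) / π) ^ (I * t / 2) *
        Complex.Gamma ((1 / 2 + charParity χ + I * t) / 2) * Complex.exp (π * t / 4) *
        χ.LFunction (1 / 2 + I * t) * (Real.exp (-(t - t₀) ^ 2 / (2 * h ^ 2)) : ℂ)) (ξ + k * A)‖ ≤
      ((q : ℝ) / π) ^ ((5 / 2 - charParity χ : ℝ) / 2) * Booker2006Turing.bigZ (3 - charParity χ) *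
        Real.exp ((5 / 2 - charParity χ : ℝ) ^ 2 / (2 * h ^ 2)) *
        (∫ t : ℝ, ‖Complex.Gamma ((3 + t * I) / 2)‖ * Real.exp (π * t / 4) *
          Real.exp (-(t - t₀) ^ 2 / (2 * h ^ 2))) *
        Real.exp ((5 / 2 - charParity χ : ℝ) * (π * A)) *
        Real.exp (-((5 / 2 - charParity χ : ℝ) * (2 * π * A)) * |(k : ℝ)|) := by
  have ha1 : (charParity χ : ℝ) ≤ 1 := by exact_mod_cast charParity_le_one χ
  have hMpos : 0 < (5 / 2 - charParity χ : ℝ) := by linarith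
  have hb := norm_fourier_window_le_abs hq hχ hθ t₀ hh (ξ + k * A)
  refine hb.trans ?_
  have hZ : 0 < Booker2006Turing.bigZ (3 - charParity χ) := Booker2006Turing.bigZ_pos (by linarith)
  have hP : 0 ≤ ∫ t : ℝ, ‖Complex.Gamma ((3 + t * I) / 2)‖ * Real.exp (π * t / 4) *
      Real.exp (-(t - t₀) ^ 2 / (2 * h ^ 2)) :=
    integral_nonneg fun t => by positivity
  have hC : 0 ≤ ((q : ℝ) / π) ^ ((5 / 2 - charParity χ : ℝ) / 2) *
      Booker2006Turing.bigZ (3 - charParity χ) *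
      Real.exp ((5 / 2 - charParity χ : ℝ) ^ 2 / (2 * h ^ 2)) *
      (∫ t : ℝ, ‖Complex.Gamma ((3 + t * I) / 2)‖ * Real.exp (π * t / 4) *
        Real.exp (-(t - t₀) ^ 2 / (2 * h ^ 2))) := by positivity
  -- `|ξ + kA| ≥ |k| A − A/2`
  have habs : |(k : ℝ)| * A - A / 2 ≤ |ξ + k * A| := by
    have h1 : |(k : ℝ) * A| ≤ |ξ + k * A| + |ξ| := by
      have := abs_add_le (ξ + k * A) (-ξ)
      rw [abs_neg] at this
      simpa using this
    have h2 : |ξ| ≤ A / 2 := abs_le.mpr ⟨by linarith [hξ.1], hξ.2⟩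
    rw [abs_mul, abs_of_pos hA] at h1
    linarith
  rw [mul_assoc _ (Real.exp ((5 / 2 - charParity χ : ℝ) * (π * A))), ← Real.exp_add]
  refine mul_le_mul_of_nonneg_left (Real.exp_le_exp.mpr ?_) hC
  have hM2 : 0 ≤ 2 * π * (5 / 2 - charParity χ : ℝ) := by positivity
  have hkey := mul_le_mul_of_nonneg_left habs hM2
  linarith [hkey]

/-! ## §4 The aliasing error of the cardinal series of `W(t, χ)` (Theorem 8.2 + Lemma 8.5) -/

/-- **Aliasing: Theorem 8.2 applied to `W(t, χ)`, with Lemma 8.5's bound.** For `χ` primitive modulo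
`q > 1`, Platt's phase `ε_χ = e^{-iθ}` (`e^{2iθ} = ε(χ)`, so that `W` is real), `h, A > 0` and every real
`t`: the cardinal series of `W(·, χ)` at spacing `1/A` converges and
`|W(t, χ) − Σ_{n ∈ ℤ} W(n/A, χ) sinc(π(At − n))| ≤ I_χ(A) ≤ 2 (q/π)^{M/2} ζ(M + 1/2) e^{M²/(2h²) − πAM} P(t₀, h)/(πM)`,
`M = 5/2 − a_χ` — the second "source of error" of p. 3021 bounded by Lemma 8.5 (`platt2016_lemma85`),
Theorem 8.2 in the tree's cell-bound form (`Upsampling.norm_sub_tsum_sample_mul_sinc_le_of_cell_bound`,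
no bounded-variation hypothesis needed: the spectrum of `W` decays like `e^{-2πM|ξ|}`).
[cite: Platt2016GRH, Theorem 8.2 p. 3021 and Lemma 8.5 p. 3022] -/
theorem platt2016_upsampling_aliasing {q : ℕ} [NeZero q] (hq : 1 < q)
    {χ : DirichletCharacter ℂ q} (hχ : χ.IsPrimitive) {θ : ℝ}
    (hθ : Complex.exp (2 * θ * I) = rootNumber χ) {h A : ℝ} (hh : 0 < h) (hA : 0 < A) (t₀ t : ℝ) :
    Summable (fun n : ℤ => Complex.exp (-(θ * I)) * ((q : ℂ) / π) ^ (I * ((n : ℝ) / A : ℝ) / 2) *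
        Complex.Gamma ((1 / 2 + charParity χ + I * ((n : ℝ) / A : ℝ)) / 2) *
        Complex.exp (π * ((n : ℝ) / A : ℝ) / 4) * χ.LFunction (1 / 2 + I * ((n : ℝ) / A : ℝ)) *
        (Real.exp (-((n : ℝ) / A - t₀) ^ 2 / (2 * h ^ 2)) : ℂ) *
        (Real.sinc (π * (A * t - n)) : ℂ)) ∧
    ‖Complex.exp (-(θ * I)) * ((q : ℂ) / π) ^ (I * t / 2) *
        Complex.Gamma ((1 / 2 + charParity χ + I * t) / 2) * Complex.exp (π * t / 4) *
        χ.LFunction (1 / 2 + I * t) * (Real.exp (-(t - t₀) ^ 2 / (2 * h ^ 2)) : ℂ) -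
      ∑' n : ℤ, Complex.exp (-(θ * I)) * ((q : ℂ) / π) ^ (I * ((n : ℝ) / A : ℝ) / 2) *
        Complex.Gamma ((1 / 2 + charParity χ + I * ((n : ℝ) / A : ℝ)) / 2) *
        Complex.exp (π * ((n : ℝ) / A : ℝ) / 4) * χ.LFunction (1 / 2 + I * ((n : ℝ) / A : ℝ)) *
        (Real.exp (-((n : ℝ) / A - t₀) ^ 2 / (2 * h ^ 2)) : ℂ) *
        (Real.sinc (π * (A * t - n)) : ℂ)‖ ≤
      2 * ((q : ℝ) / π) ^ ((5 / 2 - charParity χ : ℝ) / 2) *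
        Booker2006Turing.bigZ ((5 / 2 - charParity χ : ℝ) + 1 / 2) *
        Real.exp ((5 / 2 - charParity χ : ℝ) ^ 2 / (2 * h ^ 2) - π * A * (5 / 2 - charParity χ : ℝ)) *
        (∫ t : ℝ, ‖Complex.Gamma ((3 + t * I) / 2)‖ * Real.exp (π * t / 4) *
          Real.exp (-(t - t₀) ^ 2 / (2 * h ^ 2))) / (π * (5 / 2 - charParity χ : ℝ)) := by
  set W : ℝ → ℂ := fun t : ℝ => Complex.exp (-(θ * I)) * ((q : ℂ) / π) ^ (I * t / 2) *
        Complex.Gamma ((1 / 2 + charParity χ + I * t) / 2) * Complex.exp (π * t / 4) *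
        χ.LFunction (1 / 2 + I * t) * (Real.exp (-(t - t₀) ^ 2 / (2 * h ^ 2)) : ℂ) with hW
  have ha1 : (charParity χ : ℝ) ≤ 1 := by exact_mod_cast charParity_le_one χ
  have hMpos : 0 < (5 / 2 - charParity χ : ℝ) := by linarith
  have hε := norm_phase θ
  have hcont : Continuous W := continuous_window hq hχ _ t₀ h
  have hint : Integrable W := integrable_window hq hχ hε t₀ hh
  have hFi : Integrable (𝓕 W) := integrable_fourier_window hq hχ hθ t₀ hh
  -- the cell bounds
  set C : ℝ := ((q : ℝ) / π) ^ ((5 / 2 - charParity χ : ℝ) / 2) *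
        Booker2006Turing.bigZ (3 - charParity χ) *
        Real.exp ((5 / 2 - charParity χ : ℝ) ^ 2 / (2 * h ^ 2)) *
        (∫ t : ℝ, ‖Complex.Gamma ((3 + t * I) / 2)‖ * Real.exp (π * t / 4) *
          Real.exp (-(t - t₀) ^ 2 / (2 * h ^ 2))) *
        Real.exp ((5 / 2 - charParity χ : ℝ) * (π * A)) with hC
  set Mk : ℤ → ℝ := fun k => C * Real.exp (-((5 / 2 - charParity χ : ℝ) * (2 * π * A)) * |(k : ℝ)|)
    with hMk
  have hMsum : Summable Mk :=
    (summable_exp_neg_mul_abs_int (c := (5 / 2 - charParity χ : ℝ) * (2 * π * A))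
      (by positivity)).mul_left C
  have hbd : ∀ (k : ℤ) (ξ : ℝ), ξ ∈ Ioc (-(A / 2)) (A / 2) → ‖𝓕 W (ξ + k * A)‖ ≤ Mk k :=
    fun k ξ hξ => by
      simp only [hMk, hC, hW]
      exact fourier_window_cell_bound hq hχ hθ t₀ hh hA k ξ hξ
  have hsum := (Upsampling.hasSum_sample_mul_sinc_of_cell_bound hcont hint hFi hA hMsum hbd t).summable
  have hle := Upsampling.norm_sub_tsum_sample_mul_sinc_le_of_cell_bound hcont hint hFi hA hMsum hbd t
  -- the real signal: `2 ∫_{window^c} = 4 ∫_{A/2}^∞ = I_χ(A)`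
  have hreal : ∀ t : ℝ, (W t).im = 0 := fun t => by
    simp only [hW]
    rw [Complex.im_mul_ofReal, platt2016_completedL_real hq hχ hθ t, zero_mul]
  have hsymm : ∀ ξ, ‖𝓕 W (-ξ)‖ = ‖𝓕 W ξ‖ := norm_fourier_neg_of_im_eq_zero hreal
  rw [two_mul_integral_compl_window hsymm hFi hA.le, ← Upsampling.integral_Ioi_norm_plattFourier] at hle
  -- Lemma 8.5
  have h85 := platt2016_lemma85 hq hχ hε t₀ hh A (5 / 2 - charParity χ : ℝ) rfl
  have hI : ∫ x in Ioi (π * A), ‖((1 / (2 * π) : ℂ) * ∫ t : ℝ, W t * cexp (-(I * t * x)))‖ =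
      ∫ x in Ioi (π * A), 1 / (2 * π) * ‖∫ t : ℝ, W t * Complex.exp (-I * x * t)‖ := by
    refine integral_congr_ae (ae_of_all _ fun x => ?_)
    simp only []
    rw [norm_mul, show ((1 / (2 * π) : ℂ)) = (((1 / (2 * π) : ℝ)) : ℂ) by push_cast; ring,
      Complex.norm_real, Real.norm_of_nonneg (by positivity)]
    congr 2
    refine integral_congr_ae (ae_of_all _ fun t => ?_)
    simp only []
    congr 1
    congr 1
    ring
  rw [hI] at hle
  refine ⟨?_, hle.trans h85⟩
  simpa only [hW] using hsum

end UpsamplingError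

open UpsamplingError UpsamplingTruncation

/-! ## §5 The up-sampling certificate: aliasing (Thm 8.2 + Lemma 8.5) + truncation (Lemma 8.7) -/

/-- **Platt's rigorous up-sampling bound, assembled (§8 p. 3021: "To apply Theorem 8.1 rigorously, we
need to examine two sources of error: the error introduced by truncating the sum, and the error
introduced if the function is only approximately band-limited").** For `χ` primitive modulo `q > 1`,
Platt's phase `ε_χ = e^{-iθ}` with `e^{2iθ} = ε(χ)` (so that `Λ_χ` is real, p. 3009), `h, A > 0`,
`S ∈ ℤ_{>0}` with `A h ≤ S`, and a real `t₀ ≥ 0` that is "large enough"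
(`√(2π) e^{π/8+1/4} ≤ √π e^{1/6} (3 + 2t₀)^{1/4}`; `t₀ ≥ 12` suffices, see
`platt2016_upsampling_error_of_twelve_le`): the value `Λ_χ(t₀) = W(t₀, χ)` is recovered from the
`2S - 1` (or `2S`) samples `W(n/A, χ)`, `|n - At₀| < S`, of the lattice of spacing `1/A` up to
`|Λ_χ(t₀) - Σ_{|n - At₀| < S} W(n/A, χ) sinc(πA(n/A - t₀))| ≤ I_χ-bound of Lemma 8.5 + E-bound of Lemma 8.7`
`= 2 (q/π)^{M/2} ζ(M+1/2) e^{M²/(2h²) - πAM} P(t₀, h)/(πM) + √π ζ(9/8) e^{1/6} 2^{5/4} (q/2π)^{5/16} G(0)/(1 - G(1)/G(0))`,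
`M = 5/2 - a_χ`, `P` the integral of Lemma 8.4 (bounded there by `hπ(t₀ + h/√(2π) + 1 + 1/(2√2))`,
`platt2016_lemma84`), `G` the majorant of Lemma 8.6. Ingredients: `platt2016_upsampling_aliasing`
(Theorem 8.2 for `W` + Lemma 8.5) and `platt2016_lemma87` (the tails), glued by
`Σ_ℤ = Σ_{|n - At₀| < S} + Σ_{|n - At₀| ≥ S}`.
[cite: Platt2016GRH, §8 p. 3021 ("two sources of error") with Lemma 8.5 p. 3022 and Lemma 8.7 p. 3023] -/
theorem platt2016_upsampling_error {q : ℕ} [NeZero q] (hq : 1 < q)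
    {χ : DirichletCharacter ℂ q} (hχ : χ.IsPrimitive) {θ : ℝ}
    (hθ : Complex.exp (2 * θ * I) = rootNumber χ) {h A t₀ : ℝ} (hh : 0 < h) (hA : 0 < A)
    (ht₀ : 0 ≤ t₀)
    (hlarge : Real.sqrt (2 * π) * Real.exp (π / 8 + 1 / 4) ≤
      Real.sqrt π * Real.exp (1 / 6) * (3 + 2 * t₀) ^ (1 / 4 : ℝ))
    {S : ℕ} (hS : 0 < S) (hSAh : A * h ≤ S) :
    ‖Complex.exp (-(θ * I)) * ((q : ℂ) / π) ^ (I * t₀ / 2) *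
        Complex.Gamma ((1 / 2 + charParity χ + I * t₀) / 2) * Complex.exp (π * t₀ / 4) *
        χ.LFunction (1 / 2 + I * t₀) -
      ∑' n : {n : ℤ // |(n : ℝ) - A * t₀| < S},
        Complex.exp (-(θ * I)) * ((q : ℂ) / π) ^ (I * ((n : ℝ) / A : ℝ) / 2) *
          Complex.Gamma ((1 / 2 + charParity χ + I * ((n : ℝ) / A : ℝ)) / 2) *
          Complex.exp (π * ((n : ℝ) / A : ℝ) / 4) * χ.LFunction (1 / 2 + I * ((n : ℝ) / A : ℝ)) *
          (Real.exp (-((n : ℝ) / A - t₀) ^ 2 / (2 * h ^ 2)) : ℂ) *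
          (Real.sinc (π * A * ((n : ℝ) / A - t₀)) : ℂ)‖ ≤
      2 * ((q : ℝ) / π) ^ ((5 / 2 - charParity χ : ℝ) / 2) *
          Booker2006Turing.bigZ ((5 / 2 - charParity χ : ℝ) + 1 / 2) *
          Real.exp ((5 / 2 - charParity χ : ℝ) ^ 2 / (2 * h ^ 2) - π * A * (5 / 2 - charParity χ : ℝ)) *
          (∫ t : ℝ, ‖Complex.Gamma ((3 + t * I) / 2)‖ * Real.exp (π * t / 4) *
            Real.exp (-(t - t₀) ^ 2 / (2 * h ^ 2))) / (π * (5 / 2 - charParity χ : ℝ)) +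
        Real.sqrt π * Booker2006Turing.bigZ (9 / 8) * Real.exp (1 / 6) * (2 : ℝ) ^ (5 / 4 : ℝ) *
            ((q : ℝ) / (2 * π)) ^ (5 / 16 : ℝ) *
          (((3 / 2 + t₀ + S / A) ^ (9 / 16 : ℝ) * Real.exp (-(S : ℝ) ^ 2 / (2 * A ^ 2 * h ^ 2)) /
              (π * S)) /
            (1 - ((3 / 2 + t₀ + (S + 1) / A) ^ (9 / 16 : ℝ) *
                  Real.exp (-((S : ℝ) + 1) ^ 2 / (2 * A ^ 2 * h ^ 2)) / (π * (S + 1))) /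
              ((3 / 2 + t₀ + S / A) ^ (9 / 16 : ℝ) * Real.exp (-(S : ℝ) ^ 2 / (2 * A ^ 2 * h ^ 2)) /
                (π * S)))) := by
  -- the window and the summand
  set W : ℝ → ℂ := fun t : ℝ => Complex.exp (-(θ * I)) * ((q : ℂ) / π) ^ (I * t / 2) *
        Complex.Gamma ((1 / 2 + charParity χ + I * t) / 2) * Complex.exp (π * t / 4) *
        χ.LFunction (1 / 2 + I * t) * (Real.exp (-(t - t₀) ^ 2 / (2 * h ^ 2)) : ℂ) with hW
  set F : ℤ → ℂ := fun n : ℤ => Complex.exp (-(θ * I)) * ((q : ℂ) / π) ^ (I * ((n : ℝ) / A : ℝ) / 2) *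
          Complex.Gamma ((1 / 2 + charParity χ + I * ((n : ℝ) / A : ℝ)) / 2) *
          Complex.exp (π * ((n : ℝ) / A : ℝ) / 4) * χ.LFunction (1 / 2 + I * ((n : ℝ) / A : ℝ)) *
          (Real.exp (-((n : ℝ) / A - t₀) ^ 2 / (2 * h ^ 2)) : ℂ) *
          (Real.sinc (π * A * ((n : ℝ) / A - t₀)) : ℂ) with hF
  -- (a) aliasing at `t = t₀`, in the `sinc(πA(n/A - t₀))` spelling
  obtain ⟨hsum', hal'⟩ := platt2016_upsampling_aliasing hq hχ hθ hh hA t₀ t₀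
  have hsinc : ∀ n : ℤ, Real.sinc (π * (A * t₀ - n)) = Real.sinc (π * A * ((n : ℝ) / A - t₀)) := by
    intro n
    rw [← Real.sinc_neg]
    congr 1
    field_simp
    ring
  simp_rw [hsinc] at hsum' hal'
  have hsum : Summable F := hsum'
  have hal : ‖W t₀ - ∑' n : ℤ, F n‖ ≤ _ := hal'
  -- (b) `W(t₀) = Λ_χ(t₀)`
  have hWt₀ : W t₀ = Complex.exp (-(θ * I)) * ((q : ℂ) / π) ^ (I * t₀ / 2) *
      Complex.Gamma ((1 / 2 + charParity χ + I * t₀) / 2) * Complex.exp (π * t₀ / 4) *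
      χ.LFunction (1 / 2 + I * t₀) := by
    simp only [hW, sub_self, ne_eq, OfNat.ofNat_ne_zero, not_false_eq_true, zero_pow, neg_zero,
      zero_div, Real.exp_zero, Complex.ofReal_one, mul_one]
  -- (c) the tails (Lemma 8.7)
  obtain ⟨_, htail⟩ := platt2016_lemma87 hq hχ (norm_phase θ) hh hA ht₀ hlarge hS hSAh
    (ε := Complex.exp (-(θ * I)))
  -- (d) splitting the series
  set sI : Set ℤ := {n : ℤ | |(n : ℝ) - A * t₀| < S} with hsI
  have hsplit := hsum.tsum_subtype_add_tsum_subtype_compl sI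
  have hsc : sIᶜ = {n : ℤ | (S : ℝ) ≤ |(n : ℝ) - A * t₀|} := by
    ext n; simp [hsI, not_lt]
  rw [tsum_congr_set_coe F hsc] at hsplit
  have e1 : (∑' n : {n : ℤ // |(n : ℝ) - A * t₀| < S}, F n) = ∑' n : sI, F n := rfl
  have e2 : (∑' n : ({n : ℤ | (S : ℝ) ≤ |(n : ℝ) - A * t₀|} : Set ℤ), F n) =
      ∑' n : {n : ℤ // (S : ℝ) ≤ |(n : ℝ) - A * t₀|}, F n := rfl
  rw [e2] at hsplit
  -- (e) assemble
  have hid : Complex.exp (-(θ * I)) * ((q : ℂ) / π) ^ (I * t₀ / 2) *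
        Complex.Gamma ((1 / 2 + charParity χ + I * t₀) / 2) * Complex.exp (π * t₀ / 4) *
        χ.LFunction (1 / 2 + I * t₀) - ∑' n : {n : ℤ // |(n : ℝ) - A * t₀| < S}, F n =
      (W t₀ - ∑' n : ℤ, F n) + ∑' n : {n : ℤ // (S : ℝ) ≤ |(n : ℝ) - A * t₀|}, F n := by
    rw [← hWt₀, e1, ← hsplit]
    ring
  show ‖Complex.exp (-(θ * I)) * ((q : ℂ) / π) ^ (I * t₀ / 2) *
        Complex.Gamma ((1 / 2 + charParity χ + I * t₀) / 2) * Complex.exp (π * t₀ / 4) *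
        χ.LFunction (1 / 2 + I * t₀) - ∑' n : {n : ℤ // |(n : ℝ) - A * t₀| < S}, F n‖ ≤ _
  rw [hid]
  exact (norm_add_le _ _).trans (add_le_add hal htail)

/-- **The up-sampling certificate for `t₀ ≥ 12`** ("large enough `t₀`" discharged by
`UpsamplingTruncation.large_enough_of_twelve_le`).
[cite: Platt2016GRH, §8 p. 3021 ("two sources of error") with Lemma 8.5 p. 3022 and Lemma 8.7 p. 3023] -/
theorem platt2016_upsampling_error_of_twelve_le {q : ℕ} [NeZero q] (hq : 1 < q)
    {χ : DirichletCharacter ℂ q} (hχ : χ.IsPrimitive) {θ : ℝ}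
    (hθ : Complex.exp (2 * θ * I) = rootNumber χ) {h A t₀ : ℝ} (hh : 0 < h) (hA : 0 < A)
    (ht₀ : 12 ≤ t₀) {S : ℕ} (hS : 0 < S) (hSAh : A * h ≤ S) :
    ‖Complex.exp (-(θ * I)) * ((q : ℂ) / π) ^ (I * t₀ / 2) *
        Complex.Gamma ((1 / 2 + charParity χ + I * t₀) / 2) * Complex.exp (π * t₀ / 4) *
        χ.LFunction (1 / 2 + I * t₀) -
      ∑' n : {n : ℤ // |(n : ℝ) - A * t₀| < S},
        Complex.exp (-(θ * I)) * ((q : ℂ) / π) ^ (I * ((n : ℝ) / A : ℝ) / 2) *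
          Complex.Gamma ((1 / 2 + charParity χ + I * ((n : ℝ) / A : ℝ)) / 2) *
          Complex.exp (π * ((n : ℝ) / A : ℝ) / 4) * χ.LFunction (1 / 2 + I * ((n : ℝ) / A : ℝ)) *
          (Real.exp (-((n : ℝ) / A - t₀) ^ 2 / (2 * h ^ 2)) : ℂ) *
          (Real.sinc (π * A * ((n : ℝ) / A - t₀)) : ℂ)‖ ≤
      2 * ((q : ℝ) / π) ^ ((5 / 2 - charParity χ : ℝ) / 2) *
          Booker2006Turing.bigZ ((5 / 2 - charParity χ : ℝ) + 1 / 2) *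
          Real.exp ((5 / 2 - charParity χ : ℝ) ^ 2 / (2 * h ^ 2) - π * A * (5 / 2 - charParity χ : ℝ)) *
          (∫ t : ℝ, ‖Complex.Gamma ((3 + t * I) / 2)‖ * Real.exp (π * t / 4) *
            Real.exp (-(t - t₀) ^ 2 / (2 * h ^ 2))) / (π * (5 / 2 - charParity χ : ℝ)) +
        Real.sqrt π * Booker2006Turing.bigZ (9 / 8) * Real.exp (1 / 6) * (2 : ℝ) ^ (5 / 4 : ℝ) *
            ((q : ℝ) / (2 * π)) ^ (5 / 16 : ℝ) *
          (((3 / 2 + t₀ + S / A) ^ (9 / 16 : ℝ) * Real.exp (-(S : ℝ) ^ 2 / (2 * A ^ 2 * h ^ 2)) /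
              (π * S)) /
            (1 - ((3 / 2 + t₀ + (S + 1) / A) ^ (9 / 16 : ℝ) *
                  Real.exp (-((S : ℝ) + 1) ^ 2 / (2 * A ^ 2 * h ^ 2)) / (π * (S + 1))) /
              ((3 / 2 + t₀ + S / A) ^ (9 / 16 : ℝ) * Real.exp (-(S : ℝ) ^ 2 / (2 * A ^ 2 * h ^ 2)) /
                (π * S)))) :=
  platt2016_upsampling_error hq hχ hθ hh hA (by linarith) (large_enough_of_twelve_le ht₀) hS hSAh

/-- **The up-sampling certificate for EVERY `t₀ ≥ 0`** (no largeness condition; the zeros of `Λ_χ`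
near the real axis are located the same way), with the truncation constant of
`platt2016_lemma87_uniform`: `√π e^{1/6}` replaced by `max(√π e^{1/6}, √(2π) e^{π/8+1/4}/3^{1/4})` so that
both branches of Lemma 8.3 are covered.
[cite: Platt2016GRH, §8 p. 3021 ("two sources of error") with Lemma 8.5 p. 3022, Lemma 8.7 p. 3023 and Lemma 8.3 p. 3021] -/
theorem platt2016_upsampling_error_uniform {q : ℕ} [NeZero q] (hq : 1 < q)
    {χ : DirichletCharacter ℂ q} (hχ : χ.IsPrimitive) {θ : ℝ}
    (hθ : Complex.exp (2 * θ * I) = rootNumber χ) {h A t₀ : ℝ} (hh : 0 < h) (hA : 0 < A)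
    (ht₀ : 0 ≤ t₀) {S : ℕ} (hS : 0 < S) (hSAh : A * h ≤ S) :
    ‖Complex.exp (-(θ * I)) * ((q : ℂ) / π) ^ (I * t₀ / 2) *
        Complex.Gamma ((1 / 2 + charParity χ + I * t₀) / 2) * Complex.exp (π * t₀ / 4) *
        χ.LFunction (1 / 2 + I * t₀) -
      ∑' n : {n : ℤ // |(n : ℝ) - A * t₀| < S},
        Complex.exp (-(θ * I)) * ((q : ℂ) / π) ^ (I * ((n : ℝ) / A : ℝ) / 2) *
          Complex.Gamma ((1 / 2 + charParity χ + I * ((n : ℝ) / A : ℝ)) / 2) *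
          Complex.exp (π * ((n : ℝ) / A : ℝ) / 4) * χ.LFunction (1 / 2 + I * ((n : ℝ) / A : ℝ)) *
          (Real.exp (-((n : ℝ) / A - t₀) ^ 2 / (2 * h ^ 2)) : ℂ) *
          (Real.sinc (π * A * ((n : ℝ) / A - t₀)) : ℂ)‖ ≤
      2 * ((q : ℝ) / π) ^ ((5 / 2 - charParity χ : ℝ) / 2) *
          Booker2006Turing.bigZ ((5 / 2 - charParity χ : ℝ) + 1 / 2) *
          Real.exp ((5 / 2 - charParity χ : ℝ) ^ 2 / (2 * h ^ 2) - π * A * (5 / 2 - charParity χ : ℝ)) *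
          (∫ t : ℝ, ‖Complex.Gamma ((3 + t * I) / 2)‖ * Real.exp (π * t / 4) *
            Real.exp (-(t - t₀) ^ 2 / (2 * h ^ 2))) / (π * (5 / 2 - charParity χ : ℝ)) +
        max (Real.sqrt π * Real.exp (1 / 6))
            (Real.sqrt (2 * π) * Real.exp (π / 8 + 1 / 4) / (3 : ℝ) ^ (1 / 4 : ℝ)) *
            Booker2006Turing.bigZ (9 / 8) * (2 : ℝ) ^ (5 / 4 : ℝ) * ((q : ℝ) / (2 * π)) ^ (5 / 16 : ℝ) *
          (((3 / 2 + t₀ + S / A) ^ (9 / 16 : ℝ) * Real.exp (-(S : ℝ) ^ 2 / (2 * A ^ 2 * h ^ 2)) /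
              (π * S)) /
            (1 - ((3 / 2 + t₀ + (S + 1) / A) ^ (9 / 16 : ℝ) *
                  Real.exp (-((S : ℝ) + 1) ^ 2 / (2 * A ^ 2 * h ^ 2)) / (π * (S + 1))) /
              ((3 / 2 + t₀ + S / A) ^ (9 / 16 : ℝ) * Real.exp (-(S : ℝ) ^ 2 / (2 * A ^ 2 * h ^ 2)) /
                (π * S)))) := by
  set W : ℝ → ℂ := fun t : ℝ => Complex.exp (-(θ * I)) * ((q : ℂ) / π) ^ (I * t / 2) *
        Complex.Gamma ((1 / 2 + charParity χ + I * t) / 2) * Complex.exp (π * t / 4) *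
        χ.LFunction (1 / 2 + I * t) * (Real.exp (-(t - t₀) ^ 2 / (2 * h ^ 2)) : ℂ) with hW
  set F : ℤ → ℂ := fun n : ℤ => Complex.exp (-(θ * I)) * ((q : ℂ) / π) ^ (I * ((n : ℝ) / A : ℝ) / 2) *
          Complex.Gamma ((1 / 2 + charParity χ + I * ((n : ℝ) / A : ℝ)) / 2) *
          Complex.exp (π * ((n : ℝ) / A : ℝ) / 4) * χ.LFunction (1 / 2 + I * ((n : ℝ) / A : ℝ)) *
          (Real.exp (-((n : ℝ) / A - t₀) ^ 2 / (2 * h ^ 2)) : ℂ) *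
          (Real.sinc (π * A * ((n : ℝ) / A - t₀)) : ℂ) with hF
  obtain ⟨hsum', hal'⟩ := platt2016_upsampling_aliasing hq hχ hθ hh hA t₀ t₀
  have hsinc : ∀ n : ℤ, Real.sinc (π * (A * t₀ - n)) = Real.sinc (π * A * ((n : ℝ) / A - t₀)) := by
    intro n
    rw [← Real.sinc_neg]
    congr 1
    field_simp
    ring
  simp_rw [hsinc] at hsum' hal'
  have hsum : Summable F := hsum'
  have hal : ‖W t₀ - ∑' n : ℤ, F n‖ ≤ _ := hal'
  have hWt₀ : W t₀ = Complex.exp (-(θ * I)) * ((q : ℂ) / π) ^ (I * t₀ / 2) *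
      Complex.Gamma ((1 / 2 + charParity χ + I * t₀) / 2) * Complex.exp (π * t₀ / 4) *
      χ.LFunction (1 / 2 + I * t₀) := by
    simp only [hW, sub_self, ne_eq, OfNat.ofNat_ne_zero, not_false_eq_true, zero_pow, neg_zero,
      zero_div, Real.exp_zero, Complex.ofReal_one, mul_one]
  obtain ⟨_, htail⟩ := platt2016_lemma87_uniform hq hχ (norm_phase θ) hh hA ht₀ hS hSAh
    (ε := Complex.exp (-(θ * I)))
  set sI : Set ℤ := {n : ℤ | |(n : ℝ) - A * t₀| < S} with hsI
  have hsplit := hsum.tsum_subtype_add_tsum_subtype_compl sI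
  have hsc : sIᶜ = {n : ℤ | (S : ℝ) ≤ |(n : ℝ) - A * t₀|} := by
    ext n; simp [hsI, not_lt]
  rw [tsum_congr_set_coe F hsc] at hsplit
  have e1 : (∑' n : {n : ℤ // |(n : ℝ) - A * t₀| < S}, F n) = ∑' n : sI, F n := rfl
  have e2 : (∑' n : ({n : ℤ | (S : ℝ) ≤ |(n : ℝ) - A * t₀|} : Set ℤ), F n) =
      ∑' n : {n : ℤ // (S : ℝ) ≤ |(n : ℝ) - A * t₀|}, F n := rfl
  rw [e2] at hsplit
  have hid : Complex.exp (-(θ * I)) * ((q : ℂ) / π) ^ (I * t₀ / 2) *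
        Complex.Gamma ((1 / 2 + charParity χ + I * t₀) / 2) * Complex.exp (π * t₀ / 4) *
        χ.LFunction (1 / 2 + I * t₀) - ∑' n : {n : ℤ // |(n : ℝ) - A * t₀| < S}, F n =
      (W t₀ - ∑' n : ℤ, F n) + ∑' n : {n : ℤ // (S : ℝ) ≤ |(n : ℝ) - A * t₀|}, F n := by
    rw [← hWt₀, e1, ← hsplit]
    ring
  show ‖Complex.exp (-(θ * I)) * ((q : ℂ) / π) ^ (I * t₀ / 2) *
        Complex.Gamma ((1 / 2 + charParity χ + I * t₀) / 2) * Complex.exp (π * t₀ / 4) *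
        χ.LFunction (1 / 2 + I * t₀) - ∑' n : {n : ℤ // |(n : ℝ) - A * t₀| < S}, F n‖ ≤ _
  rw [hid]
  exact (norm_add_le _ _).trans (add_le_add hal htail)

/-- **The up-sampling certificate in closed form:** `P(t₀, h)` replaced by its bound
`hπ(t₀ + h/√(2π) + 1 + 1/(2√2))` of Lemma 8.4 (`platt2016_lemma84`), so that every quantity on the
right is elementary in `q, a_χ, A, h, S, t₀` (and the real zeta values `ζ(3 − a_χ)`, `ζ(9/8)`).
[cite: Platt2016GRH, §8 p. 3021 ("two sources of error") with Lemma 8.4 p. 3021, Lemma 8.5 p. 3022 and Lemma 8.7 p. 3023] -/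
theorem platt2016_upsampling_error_explicit {q : ℕ} [NeZero q] (hq : 1 < q)
    {χ : DirichletCharacter ℂ q} (hχ : χ.IsPrimitive) {θ : ℝ}
    (hθ : Complex.exp (2 * θ * I) = rootNumber χ) {h A t₀ : ℝ} (hh : 0 < h) (hA : 0 < A)
    (ht₀ : 0 ≤ t₀)
    (hlarge : Real.sqrt (2 * π) * Real.exp (π / 8 + 1 / 4) ≤
      Real.sqrt π * Real.exp (1 / 6) * (3 + 2 * t₀) ^ (1 / 4 : ℝ))
    {S : ℕ} (hS : 0 < S) (hSAh : A * h ≤ S) :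
    ‖Complex.exp (-(θ * I)) * ((q : ℂ) / π) ^ (I * t₀ / 2) *
        Complex.Gamma ((1 / 2 + charParity χ + I * t₀) / 2) * Complex.exp (π * t₀ / 4) *
        χ.LFunction (1 / 2 + I * t₀) -
      ∑' n : {n : ℤ // |(n : ℝ) - A * t₀| < S},
        Complex.exp (-(θ * I)) * ((q : ℂ) / π) ^ (I * ((n : ℝ) / A : ℝ) / 2) *
          Complex.Gamma ((1 / 2 + charParity χ + I * ((n : ℝ) / A : ℝ)) / 2) *
          Complex.exp (π * ((n : ℝ) / A : ℝ) / 4) * χ.LFunction (1 / 2 + I * ((n : ℝ) / A : ℝ)) *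
          (Real.exp (-((n : ℝ) / A - t₀) ^ 2 / (2 * h ^ 2)) : ℂ) *
          (Real.sinc (π * A * ((n : ℝ) / A - t₀)) : ℂ)‖ ≤
      2 * ((q : ℝ) / π) ^ ((5 / 2 - charParity χ : ℝ) / 2) *
          Booker2006Turing.bigZ ((5 / 2 - charParity χ : ℝ) + 1 / 2) *
          Real.exp ((5 / 2 - charParity χ : ℝ) ^ 2 / (2 * h ^ 2) - π * A * (5 / 2 - charParity χ : ℝ)) *
          (h * π * (t₀ + h / Real.sqrt (2 * π) + 1 + 1 / (2 * Real.sqrt 2))) /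
          (π * (5 / 2 - charParity χ : ℝ)) +
        Real.sqrt π * Booker2006Turing.bigZ (9 / 8) * Real.exp (1 / 6) * (2 : ℝ) ^ (5 / 4 : ℝ) *
            ((q : ℝ) / (2 * π)) ^ (5 / 16 : ℝ) *
          (((3 / 2 + t₀ + S / A) ^ (9 / 16 : ℝ) * Real.exp (-(S : ℝ) ^ 2 / (2 * A ^ 2 * h ^ 2)) /
              (π * S)) /
            (1 - ((3 / 2 + t₀ + (S + 1) / A) ^ (9 / 16 : ℝ) *
                  Real.exp (-((S : ℝ) + 1) ^ 2 / (2 * A ^ 2 * h ^ 2)) / (π * (S + 1))) /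
              ((3 / 2 + t₀ + S / A) ^ (9 / 16 : ℝ) * Real.exp (-(S : ℝ) ^ 2 / (2 * A ^ 2 * h ^ 2)) /
                (π * S)))) := by
  have h0 := platt2016_upsampling_error hq hχ hθ hh hA ht₀ hlarge hS hSAh
  refine h0.trans (add_le_add ?_ le_rfl)
  have ha1 : (charParity χ : ℝ) ≤ 1 := by exact_mod_cast charParity_le_one χ
  have hMpos : 0 < (5 / 2 - charParity χ : ℝ) := by linarith
  have hZ : 0 < Booker2006Turing.bigZ ((5 / 2 - charParity χ : ℝ) + 1 / 2) :=
    Booker2006Turing.bigZ_pos (by linarith)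
  have hP := platt2016_lemma84 ht₀ hh
  have hq0 : (0 : ℝ) < q := by exact_mod_cast (by omega : 0 < q)
  have hK : 0 ≤ 2 * ((q : ℝ) / π) ^ ((5 / 2 - charParity χ : ℝ) / 2) *
      Booker2006Turing.bigZ ((5 / 2 - charParity χ : ℝ) + 1 / 2) *
      Real.exp ((5 / 2 - charParity χ : ℝ) ^ 2 / (2 * h ^ 2) - π * A * (5 / 2 - charParity χ : ℝ)) := by
    positivity
  exact div_le_div_of_nonneg_right (mul_le_mul_of_nonneg_left hP hK) (by positivity)

end Literature.NumberTheory.LFunctions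

end
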